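import Summits.QuantumFields.YangMills.Theorems.LangevinControlUVOSLegsFromFemtoAndGapStubGap
import HarnessLib

/-!
# Stub `stub_cluster` of line `Sketch` (crux stmt-QuantumFields-16207 `OSLegsAtWeakCouplingC`), part I: time-like frame

Helper file for `…Cruxes.OSLegsFromFemtoAndGap.DlrCollarTransfer.stub_cluster : Statement.stub_cluster` (DefsR3 §4.3,
E4 from the decay; main file `LangevinControlUVOSLegsAtWeakCouplingCStubCluster.lean`).  Continuum functional analysis
of the connected OS form `conn S₁ F G = S₁(ΘF* ⊗ G) − S₁(ΘF*) S₁(G)` of a one-field family `S₁` on `ℝ⁴` with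
translation invariance on `⁰𝒮`, on the class of test functions supported at POSITIVE TIMES AND PAIRWISE DISTINCT
POINTS (the image of the time-ordered class under the signed transpositions of the axes used by the main file; it is
stable under real/imaginary parts and positive-time translations, and `ΘP* ⊗ Q ∈ ⁰𝒮` on it —
`isOffDiagonal_appendTensor_osAdjoint_of_posSep`):
* `conn(T_c P, T_{c'} Q) = conn(P, T_{c' − θc} Q)` (`conn_translateMulti_translateMulti_of_isOffDiagonal`); spatial
  translations are `conn`-isometries (`conn_translateMulti_self_of_apply_zero`); the semigroup law
  `conn(P, T_t Q) = conn(T_{t/2} P, T_{t/2} Q)` on the class (`conn_translateMulti_eq_half_of_posSep`);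
* `conn(P, Q) = conn(θRθ · P, R · Q)` for an invariance `R` of `S₁` on `⁰𝒮` (`conn_eq_conn_linActMulti`);
* for real compactly supported `P, Q` in the class and `t ≥ 0`:
  `‖conn(P, T_t Q)‖ ≤ (Re conn(P,P) Re conn(Q,Q))^{1/2} e^{−Δt}` from the semigroup law, `ConnCS` and `Decay`
  (`norm_conn_translateMulti_le_of_posSep`), and along any `b` with `b⁰ ≥ 0` with the factor `e^{−Δ t b⁰}` (the
  transverse part of `tb` is a `conn`-isometry);
* **`tendsto_conn_translateMulti_of_posSep`**: `conn(P, T_{tb} Q) → 0` for compactly supported `P, Q` in the class,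
  `b⁰ > 0`, `Δ > 0` (complex `P, Q` by polarisation, as in `hasMassGap_of_connCS_of_decay`).
Refs: OsterwalderSchrader1973 §3 (E4), §4.1 (4.3)–(4.7); GlimmJaffe1987 §6.1, §19.3, §19.7.
-/

set_option autoImplicit false

noncomputable section

open scoped SchwartzMap ComplexConjugate
open MeasureTheory Filter Topology
open Literature.MathematicalPhysics.QuantumFieldTheory Literature.MathematicalPhysics.QuantumLattice
open Literature.MathematicalPhysics.AQFT

namespace Summit.QuantumFields.YangMills.Theorems.OSLegsFromFemtoAndGap

open Summit.QuantumFields.YangMills.Cruxes.OSLegsFromFemtoAndGap.DlrCollarTransfer (conn Decay ConnCS)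

variable (S₁ : SchwingerFamily (EuclideanSpace ℝ (Fin 4))) {n m : ℕ}
  {P F F' : 𝓢((Fin n → EuclideanSpace ℝ (Fin 4)), ℂ)} {Q G G' : 𝓢((Fin m → EuclideanSpace ℝ (Fin 4)), ℂ)}

/-! ### Sesquilinearity complements -/

/-- `conn` vanishes on the zero test function in the first slot. -/
theorem conn_zero_left : conn S₁ (0 : 𝓢((Fin n → EuclideanSpace ℝ (Fin 4)), ℂ)) G = 0 := by
  rw [← zero_smul ℂ (0 : 𝓢((Fin n → EuclideanSpace ℝ (Fin 4)), ℂ)), conn_smul_left, map_zero, zero_mul]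

/-- `conn` is subtractive in the first slot. -/
theorem conn_sub_left : conn S₁ (F - F') G = conn S₁ F G - conn S₁ F' G := by
  rw [sub_eq_add_neg, conn_add_left, ← neg_one_smul ℂ F', conn_smul_left, map_neg, map_one]; ring

/-- `conn` is subtractive in the second slot. -/
theorem conn_sub_right : conn S₁ F (G - G') = conn S₁ F G - conn S₁ F G' := by
  rw [sub_eq_add_neg, conn_add_right, ← neg_one_smul ℂ G', conn_smul_right]; ring

/-! ### Test functions supported at positive times and pairwise distinct points -/

/-- Such a test function is positive-time. -/
theorem isPositiveTimeMulti_of_posSep (h : tsupport ⇑P ⊆ {x | (∀ k, 0 < x k 0) ∧ Function.Injective x}) :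
    IsPositiveTimeMulti P := fun _ hx => (h hx).1

/-- Such a test function is off-diagonal (its support misses the coincidence locus). -/
theorem isOffDiagonal_of_posSep (h : tsupport ⇑P ⊆ {x | (∀ k, 0 < x k 0) ∧ Function.Injective x}) :
    IsOffDiagonal P :=
  IsOffDiagonal.of_tsupport_subset fun _ hx => not_mem_coincidenceLocus_of_injective (h hx).2

/-- The class is stable under translations with non-negative time component. -/
theorem posSep_translateMulti (h : tsupport ⇑P ⊆ {x | (∀ k, 0 < x k 0) ∧ Function.Injective x})
    {v : EuclideanSpace ℝ (Fin 4)} (hv : 0 ≤ v 0) :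
    tsupport ⇑(translateMulti v P) ⊆ {x | (∀ k, 0 < x k 0) ∧ Function.Injective x} := by
  intro x hx
  obtain ⟨hpos, hinj⟩ := h (tsupport_translateMulti_subset v P hx)
  refine ⟨fun k => ?_, fun i j hij => hinj ?_⟩
  · have hk := hpos k
    simp only [PiLp.sub_apply] at hk
    linarith
  · change x i - v = x j - v
    rw [hij]

/-- The support of `R · F` is the image of the support of `F`. -/
theorem tsupport_linActMulti_subset (R : EuclideanSpace ℝ (Fin 4) ≃ₗᵢ[ℝ] EuclideanSpace ℝ (Fin 4)) :
    tsupport ⇑(linActMulti R P) ⊆ {x | (fun k => R.symm (x k)) ∈ tsupport ⇑P} := by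
  have h : ⇑(linActMulti R P) = ⇑P ∘ fun x k => R.symm (x k) := funext fun x => linActMulti_apply R P x
  rw [h]
  exact tsupport_comp_subset_preimage _ (continuous_pi fun k => R.symm.continuous.comp (continuous_apply k))

/-- Compact support is preserved by `linActMulti`. -/
theorem hasCompactSupport_linActMulti (hP : HasCompactSupport ⇑P)
    (R : EuclideanSpace ℝ (Fin 4) ≃ₗᵢ[ℝ] EuclideanSpace ℝ (Fin 4)) : HasCompactSupport ⇑(linActMulti R P) := by
  have h : ⇑(linActMulti R P) =
      ⇑P ∘ (ContinuousLinearEquiv.piCongrRight fun _ : Fin n => R.symm.toContinuousLinearEquiv).toHomeomorph := by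
    funext x; rfl
  rw [h]; exact hP.comp_homeomorph _

/-- Compact support is preserved by translations. -/
theorem hasCompactSupport_translateMulti (hP : HasCompactSupport ⇑P) (a : EuclideanSpace ℝ (Fin 4)) :
    HasCompactSupport ⇑(translateMulti a P) := by
  have h : ⇑(translateMulti a P) = ⇑P ∘ Homeomorph.subRight (fun _ : Fin n => a) := by
    funext x; simp only [translateMulti_apply, Function.comp_apply, Homeomorph.subRight_apply]; rfl
  rw [h]; exact hP.comp_homeomorph _

/-- The support of the real part `(F + F̄)/2` lies in the support of `F`. -/
theorem tsupport_realPart_subset (F : 𝓢((Fin n → EuclideanSpace ℝ (Fin 4)), ℂ)) :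
    tsupport ⇑((2⁻¹ : ℂ) • (F + starTest F)) ⊆ tsupport ⇑F :=
  (tsupport_smul_subset_right (fun _ : Fin n → EuclideanSpace ℝ (Fin 4) => (2⁻¹ : ℂ)) _).trans
    ((tsupport_add ⇑F ⇑(starTest F)).trans
      (Set.union_subset subset_rfl (tsupport_comp_subset (g := (starRingEnd ℂ)) (map_zero _) _)))

/-- The support of the imaginary part `i(F̄ − F)/2` lies in the support of `F`. -/
theorem tsupport_imagPart_subset (F : 𝓢((Fin n → EuclideanSpace ℝ (Fin 4)), ℂ)) :
    tsupport ⇑((2⁻¹ * Complex.I : ℂ) • (starTest F - F)) ⊆ tsupport ⇑F := by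
  refine (tsupport_smul_subset_right (fun _ : Fin n → EuclideanSpace ℝ (Fin 4) => (2⁻¹ * Complex.I : ℂ)) _).trans ?_
  rw [sub_eq_add_neg]
  refine (tsupport_add ⇑(starTest F) ⇑(-F)).trans
    (Set.union_subset (tsupport_comp_subset (g := (starRingEnd ℂ)) (map_zero _) _) ?_)
  exact (tsupport_neg ⇑F).le

/-- **`ΘP* ⊗ Q ∈ ⁰𝒮`** when `P` and `Q` are supported at positive times and pairwise distinct points: the arguments
of `ΘP*` carry negative, those of `Q` positive times, and within each block the points are pairwise distinct. -/
theorem isOffDiagonal_appendTensor_osAdjoint_of_posSep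
    (hP : tsupport ⇑P ⊆ {x | (∀ k, 0 < x k 0) ∧ Function.Injective x})
    (hQ : tsupport ⇑Q ⊆ {x | (∀ k, 0 < x k 0) ∧ Function.Injective x}) :
    IsOffDiagonal ((osAdjoint P).appendTensor Q) := by
  refine IsOffDiagonal.of_tsupport_subset fun x hx => ?_
  obtain ⟨hA, hB⟩ := OSReconstructionNoE1.tsupport_appendTensor_subset _ _ hx
  obtain ⟨hposP, hinjP⟩ := hP (OSReconstructionNoE1.tsupport_osAdjoint_subset P hA)
  obtain ⟨hposQ, hinjQ⟩ := hQ hB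
  have hneg : ∀ i, x (Fin.castAdd m i) 0 < 0 := fun i => by
    have h := hposP (Fin.rev i)
    simp only [Fin.rev_rev, OSReconstructionNoE1.timeReflection_apply_zero] at h
    linarith
  rw [← Fin.append_castAdd_natAdd (f := x)]
  refine not_mem_coincidenceLocus_of_injective (Fin.append_injective_iff.2 ⟨?_, hinjQ, ?_⟩)
  · intro i j hij
    have hij' : x (Fin.castAdd m i) = x (Fin.castAdd m j) := hij
    have h : timeReflection 4 (x (Fin.castAdd m (Fin.rev (Fin.rev i)))) =
        timeReflection 4 (x (Fin.castAdd m (Fin.rev (Fin.rev j)))) := by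
      rw [Fin.rev_rev, Fin.rev_rev, hij']
    exact Fin.rev_injective (hinjP h)
  · intro i j hij
    have h0 := congrArg (fun v : EuclideanSpace ℝ (Fin 4) => v 0) hij
    simp only at h0
    linarith [hneg i, hposQ j]

/-! ### Translations and isometries of the connected OS form -/

/-- **General translation rule** `conn(T_c P, T_{c'} Q) = conn(P, T_{c' − θc} Q)` for off-diagonal `P, Q` with
`ΘP* ⊗ T_{c' − θc} Q ∈ ⁰𝒮`: `Θ(T_c P)* = T_{θc} ΘP*`, `T_{θc} ΘP* ⊗ T_{c'} Q = T_{θc}(ΘP* ⊗ T_{c'−θc} Q)`, and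
translation invariance of `S₁` on the three off-diagonal test functions. -/
theorem conn_translateMulti_translateMulti_of_isOffDiagonal
    (htrans : ∀ (n : ℕ) (t : EuclideanSpace ℝ (Fin 4)) (F : 𝓢((Fin n → EuclideanSpace ℝ (Fin 4)), ℂ)),
      IsOffDiagonal F → S₁ n (translateMulti t F) = S₁ n F)
    (hP : IsOffDiagonal P) (hQ : IsOffDiagonal Q) (c c' : EuclideanSpace ℝ (Fin 4))
    (hX : IsOffDiagonal ((osAdjoint P).appendTensor (translateMulti (c' - timeReflection 4 c) Q))) :
    conn S₁ (translateMulti c P) (translateMulti c' Q) = conn S₁ P (translateMulti (c' - timeReflection 4 c) Q) := by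
  have h3 : (translateMulti (timeReflection 4 c) (osAdjoint P)).appendTensor (translateMulti c' Q) =
      translateMulti (timeReflection 4 c)
        ((osAdjoint P).appendTensor (translateMulti (c' - timeReflection 4 c) Q)) := by
    rw [translateMulti_appendTensor, translateMulti_translateMulti, add_sub_cancel]
  unfold conn
  rw [osAdjoint_translateMulti, h3, htrans _ _ _ hX, htrans n _ _ hP.osAdjoint, htrans m _ _ hQ, htrans m _ _ hQ]

/-- **Spatial translations are `conn`-isometries**: `conn(T_v P, T_v P) = conn(P, P)` for `v⁰ = 0`. -/
theorem conn_translateMulti_self_of_apply_zero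
    (htrans : ∀ (n : ℕ) (t : EuclideanSpace ℝ (Fin 4)) (F : 𝓢((Fin n → EuclideanSpace ℝ (Fin 4)), ℂ)),
      IsOffDiagonal F → S₁ n (translateMulti t F) = S₁ n F)
    (hP : IsOffDiagonal P) (hX : IsOffDiagonal ((osAdjoint P).appendTensor P)) {v : EuclideanSpace ℝ (Fin 4)}
    (hv : v 0 = 0) : conn S₁ (translateMulti v P) (translateMulti v P) = conn S₁ P P := by
  have h := conn_translateMulti_translateMulti_of_isOffDiagonal S₁ htrans hP hP v v
  rw [OSReconstructionNoE1.timeReflection_of_apply_zero hv, sub_self, translateMulti_zero] at h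
  exact h hX

/-- `R · ΘP* = Θ(θRθ · P)*`. -/
theorem linActMulti_osAdjoint (R : EuclideanSpace ℝ (Fin 4) ≃ₗᵢ[ℝ] EuclideanSpace ℝ (Fin 4)) :
    linActMulti R (osAdjoint P) =
      osAdjoint (linActMulti ((timeReflection 4).trans (R.trans (timeReflection 4))) P) := by
  ext x
  simp [linActMulti_apply, osAdjoint_apply, LinearIsometryEquiv.symm_trans, timeReflection_timeReflection]

/-- **Rotation rule** `conn(P, Q) = conn(θRθ · P, R · Q)` for an invariance `R` of `S₁` on `⁰𝒮` and off-diagonal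
`P, Q, ΘP* ⊗ Q` (`R · (ΘP* ⊗ Q) = Θ(θRθ · P)* ⊗ R · Q`). -/
theorem conn_eq_conn_linActMulti (R : EuclideanSpace ℝ (Fin 4) ≃ₗᵢ[ℝ] EuclideanSpace ℝ (Fin 4))
    (hR : ∀ (n : ℕ) (F : 𝓢((Fin n → EuclideanSpace ℝ (Fin 4)), ℂ)),
      IsOffDiagonal F → S₁ n (linActMulti R F) = S₁ n F)
    (hP : IsOffDiagonal P) (hQ : IsOffDiagonal Q) (hX : IsOffDiagonal ((osAdjoint P).appendTensor Q)) :
    conn S₁ P Q =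
      conn S₁ (linActMulti ((timeReflection 4).trans (R.trans (timeReflection 4))) P) (linActMulti R Q) := by
  unfold conn
  rw [← hR _ _ hX, ← hR _ _ hP.osAdjoint, ← hR _ _ hQ, linActMulti_appendTensor, linActMulti_osAdjoint]

/-- **Semigroup law** on the positive-separated class: `conn(P, T_t Q) = conn(T_{t/2} P, T_{t/2} Q)` (`t ≥ 0`). -/
theorem conn_translateMulti_eq_half_of_posSep
    (htrans : ∀ (n : ℕ) (t : EuclideanSpace ℝ (Fin 4)) (F : 𝓢((Fin n → EuclideanSpace ℝ (Fin 4)), ℂ)),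
      IsOffDiagonal F → S₁ n (translateMulti t F) = S₁ n F)
    (hP : tsupport ⇑P ⊆ {x | (∀ k, 0 < x k 0) ∧ Function.Injective x})
    (hQ : tsupport ⇑Q ⊆ {x | (∀ k, 0 < x k 0) ∧ Function.Injective x}) {t : ℝ} (ht : 0 ≤ t) :
    conn S₁ P (translateMulti (EuclideanSpace.single 0 t) Q) =
      conn S₁ (translateMulti (EuclideanSpace.single 0 (t / 2)) P)
        (translateMulti (EuclideanSpace.single 0 (t / 2)) Q) := by
  have hθ : (EuclideanSpace.single 0 (t / 2) : EuclideanSpace ℝ (Fin 4)) -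
      timeReflection 4 (EuclideanSpace.single 0 (t / 2)) = EuclideanSpace.single 0 t := by
    ext j
    simp only [PiLp.sub_apply, timeReflection_apply, PiLp.single_apply]
    split_ifs <;> ring
  have ht' : (0 : ℝ) ≤ (EuclideanSpace.single 0 t : EuclideanSpace ℝ (Fin 4)) 0 := by
    simp only [PiLp.single_apply, if_true]; exact ht
  have hX : IsOffDiagonal ((osAdjoint P).appendTensor (translateMulti ((EuclideanSpace.single 0 (t / 2) :
      EuclideanSpace ℝ (Fin 4)) - timeReflection 4 (EuclideanSpace.single 0 (t / 2))) Q)) := by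
    rw [hθ]; exact isOffDiagonal_appendTensor_osAdjoint_of_posSep hP (posSep_translateMulti hQ ht')
  have h := conn_translateMulti_translateMulti_of_isOffDiagonal S₁ htrans (isOffDiagonal_of_posSep hP)
    (isOffDiagonal_of_posSep hQ) _ _ hX
  rw [hθ] at h
  exact h.symm

/-- **Exponential bound on the positive-separated class** for REAL compactly supported `P, Q` and `t ≥ 0`:
`‖conn(P, T_t Q)‖ ≤ (Re conn(P,P) · Re conn(Q,Q))^{1/2} e^{−Δt}` — semigroup law at `t/2`, `ConnCS`, `Decay`. -/
theorem norm_conn_translateMulti_le_of_posSep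
    (htrans : ∀ (n : ℕ) (t : EuclideanSpace ℝ (Fin 4)) (F : 𝓢((Fin n → EuclideanSpace ℝ (Fin 4)), ℂ)),
      IsOffDiagonal F → S₁ n (translateMulti t F) = S₁ n F)
    (hCS : ConnCS S₁) {Δ : ℝ} (hD : Decay S₁ Δ)
    (hP : tsupport ⇑P ⊆ {x | (∀ k, 0 < x k 0) ∧ Function.Injective x}) (hPc : HasCompactSupport ⇑P)
    (hPr : ∀ u, conj (P u) = P u)
    (hQ : tsupport ⇑Q ⊆ {x | (∀ k, 0 < x k 0) ∧ Function.Injective x}) (hQc : HasCompactSupport ⇑Q)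
    (hQr : ∀ u, conj (Q u) = Q u) {t : ℝ} (ht : 0 ≤ t) :
    ‖conn S₁ P (translateMulti (EuclideanSpace.single 0 t) Q)‖ ≤
      Real.sqrt ((conn S₁ P P).re * (conn S₁ Q Q).re) * Real.exp (-(Δ * t)) := by
  have hs' : (0 : ℝ) ≤ (EuclideanSpace.single 0 (t / 2) : EuclideanSpace ℝ (Fin 4)) 0 := by
    simp only [PiLp.single_apply, if_true]; positivity
  set Ps := translateMulti (EuclideanSpace.single (0 : Fin 4) (t / 2)) P with hPs_def
  set Qs := translateMulti (EuclideanSpace.single (0 : Fin 4) (t / 2)) Q with hQs_def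
  have hPs := posSep_translateMulti hP hs'
  have hQs := posSep_translateMulti hQ hs'
  obtain ⟨-, -, hCSPQ⟩ := hCS n m Ps Qs (isPositiveTimeMulti_of_posSep hPs) (isOffDiagonal_of_posSep hPs)
    (isPositiveTimeMulti_of_posSep hQs) (isOffDiagonal_of_posSep hQs)
  obtain ⟨hQQ0, -, -⟩ := hCS m m Qs Qs (isPositiveTimeMulti_of_posSep hQs) (isOffDiagonal_of_posSep hQs)
    (isPositiveTimeMulti_of_posSep hQs) (isOffDiagonal_of_posSep hQs)
  obtain ⟨hPP0', -, -⟩ := hCS n n P P (isPositiveTimeMulti_of_posSep hP) (isOffDiagonal_of_posSep hP)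
    (isPositiveTimeMulti_of_posSep hP) (isOffDiagonal_of_posSep hP)
  obtain ⟨hQQ0', -, -⟩ := hCS m m Q Q (isPositiveTimeMulti_of_posSep hQ) (isOffDiagonal_of_posSep hQ)
    (isPositiveTimeMulti_of_posSep hQ) (isOffDiagonal_of_posSep hQ)
  have hPdec : (conn S₁ Ps Ps).re ≤ (conn S₁ P P).re * Real.exp (-(Δ * t)) := by
    rw [hPs_def, ← conn_translateMulti_eq_half_of_posSep S₁ htrans hP hP ht]
    exact hD n P (isOffDiagonal_of_posSep hP) (isPositiveTimeMulti_of_posSep hP) hPc hPr t ht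
  have hQdec : (conn S₁ Qs Qs).re ≤ (conn S₁ Q Q).re * Real.exp (-(Δ * t)) := by
    rw [hQs_def, ← conn_translateMulti_eq_half_of_posSep S₁ htrans hQ hQ ht]
    exact hD m Q (isOffDiagonal_of_posSep hQ) (isPositiveTimeMulti_of_posSep hQ) hQc hQr t ht
  have hRHS : 0 ≤ Real.sqrt ((conn S₁ P P).re * (conn S₁ Q Q).re) * Real.exp (-(Δ * t)) := by positivity
  rw [conn_translateMulti_eq_half_of_posSep S₁ htrans hP hQ ht, ← sq_le_sq₀ (norm_nonneg _) hRHS, mul_pow,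
    Real.sq_sqrt (mul_nonneg hPP0' hQQ0')]
  calc ‖conn S₁ Ps Qs‖ ^ 2 ≤ (conn S₁ Ps Ps).re * (conn S₁ Qs Qs).re := hCSPQ
    _ ≤ ((conn S₁ P P).re * Real.exp (-(Δ * t))) * ((conn S₁ Q Q).re * Real.exp (-(Δ * t))) :=
        mul_le_mul hPdec hQdec hQQ0 (by positivity)
    _ = (conn S₁ P P).re * (conn S₁ Q Q).re * Real.exp (-(Δ * t)) ^ 2 := by ring

/-- The same bound along a direction `b` with `b⁰ ≥ 0`: `‖conn(P, T_{tb} Q)‖ ≤ (…)^{1/2} e^{−Δ t b⁰}` (`t ≥ 0`) —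
the transverse part of `tb` is a `conn`-isometry applied to `Q`. -/
theorem norm_conn_translateMulti_smul_le_of_posSep
    (htrans : ∀ (n : ℕ) (t : EuclideanSpace ℝ (Fin 4)) (F : 𝓢((Fin n → EuclideanSpace ℝ (Fin 4)), ℂ)),
      IsOffDiagonal F → S₁ n (translateMulti t F) = S₁ n F)
    (hCS : ConnCS S₁) {Δ : ℝ} (hD : Decay S₁ Δ)
    (hP : tsupport ⇑P ⊆ {x | (∀ k, 0 < x k 0) ∧ Function.Injective x}) (hPc : HasCompactSupport ⇑P)
    (hPr : ∀ u, conj (P u) = P u)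
    (hQ : tsupport ⇑Q ⊆ {x | (∀ k, 0 < x k 0) ∧ Function.Injective x}) (hQc : HasCompactSupport ⇑Q)
    (hQr : ∀ u, conj (Q u) = Q u) {b : EuclideanSpace ℝ (Fin 4)} (hb : 0 ≤ b 0) {t : ℝ} (ht : 0 ≤ t) :
    ‖conn S₁ P (translateMulti (t • b) Q)‖ ≤
      Real.sqrt ((conn S₁ P P).re * (conn S₁ Q Q).re) * Real.exp (-(Δ * (t * b 0))) := by
  set w : EuclideanSpace ℝ (Fin 4) := t • b - EuclideanSpace.single 0 (t * b 0) with hw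
  have hw0 : w 0 = 0 := by simp [hw]
  have hsplit : t • b = EuclideanSpace.single 0 (t * b 0) + w := by rw [hw, add_sub_cancel]
  set Q' := translateMulti w Q with hQ'_def
  have hQ' := posSep_translateMulti hQ hw0.ge
  have hQ'c : HasCompactSupport ⇑Q' := hasCompactSupport_translateMulti hQc w
  have hQ'r : ∀ u, conj (Q' u) = Q' u := fun u => by simp only [hQ'_def, translateMulti_apply]; exact hQr _
  have hT : translateMulti (t • b) Q = translateMulti (EuclideanSpace.single 0 (t * b 0)) Q' := by
    rw [hQ'_def, translateMulti_translateMulti, ← hsplit]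
  have hiso : conn S₁ Q' Q' = conn S₁ Q Q :=
    conn_translateMulti_self_of_apply_zero S₁ htrans (isOffDiagonal_of_posSep hQ)
      (isOffDiagonal_appendTensor_osAdjoint_of_posSep hQ hQ) hw0
  rw [hT, ← hiso]
  exact norm_conn_translateMulti_le_of_posSep S₁ htrans hCS hD hP hPc hPr hQ' hQ'c hQ'r (mul_nonneg ht hb)

/-- **Clustering along a time-like direction on the positive-separated class**: for compactly supported `P, Q`
supported at positive times and pairwise distinct points and `b⁰ > 0`, `conn(P, T_{tb} Q) → 0` (`Δ > 0`; complex
`P, Q` by polarisation into the real parts `(X + X̄)/2`, `i(X̄ − X)/2`). -/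
theorem tendsto_conn_translateMulti_of_posSep {Δ : ℝ} (hΔ : 0 < Δ)
    (htrans : ∀ (n : ℕ) (t : EuclideanSpace ℝ (Fin 4)) (F : 𝓢((Fin n → EuclideanSpace ℝ (Fin 4)), ℂ)),
      IsOffDiagonal F → S₁ n (translateMulti t F) = S₁ n F)
    (hCS : ConnCS S₁) (hD : Decay S₁ Δ)
    (hP : tsupport ⇑P ⊆ {x | (∀ k, 0 < x k 0) ∧ Function.Injective x}) (hPc : HasCompactSupport ⇑P)
    (hQ : tsupport ⇑Q ⊆ {x | (∀ k, 0 < x k 0) ∧ Function.Injective x}) (hQc : HasCompactSupport ⇑Q)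
    {b : EuclideanSpace ℝ (Fin 4)} (hb : 0 < b 0) :
    Tendsto (fun t : ℝ => conn S₁ P (translateMulti (t • b) Q)) atTop (𝓝 0) := by
  obtain ⟨Pr, hPr⟩ : ∃ X : 𝓢((Fin n → EuclideanSpace ℝ (Fin 4)), ℂ), X = (2⁻¹ : ℂ) • (P + starTest P) := ⟨_, rfl⟩
  obtain ⟨Pi, hPi⟩ : ∃ X : 𝓢((Fin n → EuclideanSpace ℝ (Fin 4)), ℂ), X = (2⁻¹ * Complex.I : ℂ) • (starTest P - P) :=
    ⟨_, rfl⟩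
  obtain ⟨Qr, hQr⟩ : ∃ X : 𝓢((Fin m → EuclideanSpace ℝ (Fin 4)), ℂ), X = (2⁻¹ : ℂ) • (Q + starTest Q) := ⟨_, rfl⟩
  obtain ⟨Qi, hQi⟩ : ∃ X : 𝓢((Fin m → EuclideanSpace ℝ (Fin 4)), ℂ), X = (2⁻¹ * Complex.I : ℂ) • (starTest Q - Q) :=
    ⟨_, rfl⟩
  have hPrs : tsupport ⇑Pr ⊆ tsupport ⇑P := hPr ▸ tsupport_realPart_subset P
  have hPis : tsupport ⇑Pi ⊆ tsupport ⇑P := hPi ▸ tsupport_imagPart_subset P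
  have hQrs : tsupport ⇑Qr ⊆ tsupport ⇑Q := hQr ▸ tsupport_realPart_subset Q
  have hQis : tsupport ⇑Qi ⊆ tsupport ⇑Q := hQi ▸ tsupport_imagPart_subset Q
  have hPrc : HasCompactSupport ⇑Pr := IsCompact.of_isClosed_subset hPc (isClosed_tsupport _) hPrs
  have hPic : HasCompactSupport ⇑Pi := IsCompact.of_isClosed_subset hPc (isClosed_tsupport _) hPis
  have hQrc : HasCompactSupport ⇑Qr := IsCompact.of_isClosed_subset hQc (isClosed_tsupport _) hQrs
  have hQic : HasCompactSupport ⇑Qi := IsCompact.of_isClosed_subset hQc (isClosed_tsupport _) hQis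
  have hPrR : ∀ u, conj (Pr u) = Pr u := hPr ▸ conj_realPart_apply P
  have hPiR : ∀ u, conj (Pi u) = Pi u := hPi ▸ conj_imagPart_apply P
  have hQrR : ∀ u, conj (Qr u) = Qr u := hQr ▸ conj_realPart_apply Q
  have hQiR : ∀ u, conj (Qi u) = Qi u := hQi ▸ conj_imagPart_apply Q
  have hPdec : Pr + Complex.I • Pi = P := by rw [hPr, hPi]; exact realPart_add_I_smul_imagPart P
  have hQdec : Qr + Complex.I • Qi = Q := by rw [hQr, hQi]; exact realPart_add_I_smul_imagPart Q
  set C : ℝ := Real.sqrt ((conn S₁ Pr Pr).re * (conn S₁ Qr Qr).re) + Real.sqrt ((conn S₁ Pr Pr).re * (conn S₁ Qi Qi).re) +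
    Real.sqrt ((conn S₁ Pi Pi).re * (conn S₁ Qr Qr).re) + Real.sqrt ((conn S₁ Pi Pi).re * (conn S₁ Qi Qi).re) with hC
  have hbound : ∀ t : ℝ, 0 ≤ t → ‖conn S₁ P (translateMulti (t • b) Q)‖ ≤ C * Real.exp (-(Δ * (t * b 0))) := by
    intro t ht
    rw [← hPdec, ← hQdec, map_add, map_smul, conn_add_left, conn_add_right, conn_add_right, conn_smul_right,
      conn_smul_left, conn_smul_left, conn_smul_right]
    have b1 := norm_conn_translateMulti_smul_le_of_posSep S₁ htrans hCS hD (hPrs.trans hP) hPrc hPrR (hQrs.trans hQ)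
      hQrc hQrR hb.le ht
    have b2 := norm_conn_translateMulti_smul_le_of_posSep S₁ htrans hCS hD (hPrs.trans hP) hPrc hPrR (hQis.trans hQ)
      hQic hQiR hb.le ht
    have b3 := norm_conn_translateMulti_smul_le_of_posSep S₁ htrans hCS hD (hPis.trans hP) hPic hPiR (hQrs.trans hQ)
      hQrc hQrR hb.le ht
    have b4 := norm_conn_translateMulti_smul_le_of_posSep S₁ htrans hCS hD (hPis.trans hP) hPic hPiR (hQis.trans hQ)
      hQic hQiR hb.le ht
    refine (norm_add_le _ _).trans ((add_le_add (norm_add_le _ _) (norm_add_le _ _)).trans ?_)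
    simp only [norm_mul, Complex.norm_I, Complex.conj_I, norm_neg, one_mul, hC]
    linarith [b1, b2, b3, b4]
  have hlim : Tendsto (fun t : ℝ => C * Real.exp (-(Δ * (t * b 0)))) atTop (𝓝 0) := by
    have h1 : Tendsto (fun t : ℝ => Δ * (t * b 0)) atTop atTop :=
      Tendsto.const_mul_atTop hΔ (Tendsto.atTop_mul_const hb tendsto_id)
    have h2 := (Real.tendsto_exp_neg_atTop_nhds_zero.comp h1).const_mul C
    rw [mul_zero] at h2
    exact h2
  refine squeeze_zero_norm' ?_ hlim
  filter_upwards [eventually_ge_atTop (0 : ℝ)] with t ht using hbound t ht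

end Summit.QuantumFields.YangMills.Theorems.OSLegsFromFemtoAndGap

end
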